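import Literature.AlgebraicGeometry.Frobenioids.PadicKummerThm24iiOfGalois
import Literature.AlgebraicGeometry.Frobenioids.PadicKummerLocalFieldIsoIntegers
import HarnessLib

/-!
# Frobenioids II, Theorem 2.4 (ii) for the field-isomorphism `Ψ`: the Frobenioid-side inputs are
# AUTOMATIC (cell row W12 — non-vacuity / completeness of the chain A + B + C at the binding)

Mochizuki, *The geometry of Frobenioids II*, Kyushu J. Math. **62** (2008) 401–460, §2, Theorem 2.4
(ii) p. 20 [cite: MochizukiFrdII2008, Thm 2.4 (ii) p.20].

PROOF-ONLY (abc-iut-L2-t12 g3). For the context isomorphism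
`Def22Context.Iso.ofLocalField φ₀ φ hφ L₁ L₂ hL H₁ hH₁ H₂ hH₂ hH S₁ S₂ hS` (abc-iut-L1-d4) induced by
an isomorphism of the FIELD DATA — `φ₀ : K₁ ≃ K₂` identifying the valuation rings, extended by
`φ : K̄₁ ≃ K̄₂` carrying `L₁, H₁, S₁` onto `L₂, H₂, S₂` — the inputs of `thm24ii_ofGalois_layers`
(PIECE C′) on the Frobenioid side hold BY CONSTRUCTION for `ψ̄ := φ|_{K̄₁ˣ}` (`Units.mapEquiv φ`):
* `isAlphaEquivariant_unitsMapEquiv` — `ψ̄` is `e.isoG = galConj`-equivariant (definition of `galConj`);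
* `preservesAbsUnits_unitsMapEquiv` — integrality over `𝒪_K` transports along `φ` over `φ₀|_{𝒪_{K₁}}`
  (abc-iut-L1-d4's `integerHom`; both directions);
* `isUniformizer_map` / `preservesUniformizers_unitsMapEquiv` — a valuative `φ₀` carries uniformisers of
  `K₁` to uniformisers of `K₂` (a uniformiser has the LARGEST value `< 1`, `le_unifValue_of_lt_one`, and
  `φ₀`, `φ₀⁻¹` preserve "`x/y ∈ 𝒪`");
* `muIso_ofLocalField_eq_unitsMap` — the `μ_N`-square `hO`: the `μ_N`-isomorphism induced by
  `e.isoO = φ|_{O^□_{L₁}}` IS `ψ̄` through the models `muModelOfSubmonoid` (both are `φ` on elements).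
Hence `thm24ii_ofLocalFieldIso`: the typed Theorem 2.4 (ii) for this `Ψ` and invariants pinned to the
layers' residue maps through `fnLayerMap`, with NO Frobenioid-side hypothesis left (the layers `Eᵢ`,
their residue maps and the pins remain explicit data, as in PIECE C). Classical; nothing here concerns
[IUTchIII].
-/

noncomputable section

namespace Literature.AlgebraicGeometry.Frobenioids

namespace PadicKummer

namespace Def22Context.Iso

open Field IntermediateField Kummer ValuativeRel
open scoped ValuativeRel
open Literature.NumberTheory.GaloisRepresentations
open Literature.NumberTheory.GaloisRepresentations.LocalWeilDatum
open Literature.NumberTheory.GaloisRepresentations.DiscreteGaloisModule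
open Literature.AnabelianGeometry.AbsoluteAnabelian
open Literature.AnabelianGeometry.AbsoluteAnabelian.Prop121vii

section UnitsMap

variable {K₁ K₂ : Type} [Field K₁] [Field K₂] (φ₀ : K₁ ≃+* K₂)
  (φ : AlgebraicClosure K₁ ≃+* AlgebraicClosure K₂)
  (hφ : ∀ x : K₁, φ (algebraMap K₁ (AlgebraicClosure K₁) x) =
    algebraMap K₂ (AlgebraicClosure K₂) (φ₀ x))

/-- `ψ̄ := φ|_{K̄₁ˣ}` is `galConj`-equivariant: `φ (σ x) = (φ σ φ⁻¹) (φ x)`.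
[cite: MochizukiFrdII2008, Thm 2.4 (i) p.19] -/
theorem isAlphaEquivariant_unitsMapEquiv :
    IsAlphaEquivariant (galConjₜ φ₀ φ hφ) (Units.mapEquiv φ.toMulEquiv) := by
  intro σ x
  apply Units.ext
  rw [Units.coe_mapEquiv, Units.coe_smul, Units.coe_smul, Units.coe_mapEquiv, galConjₜ_apply,
    galConj_smul]
  change φ (σ • (x : AlgebraicClosure K₁)) = φ (σ • φ.symm (φ (x : AlgebraicClosure K₁)))
  rw [RingEquiv.symm_apply_apply]

include hφ in
/-- `ψ̄ := φ|_{K̄₁ˣ}` on the image of `K₁ˣ` is `φ₀`. [cite: MochizukiFrdII2008, Thm 2.4 (i) p.19] -/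
theorem unitsMapEquiv_algebraMap (c : K₁ˣ) :
    Units.mapEquiv φ.toMulEquiv
        (Units.map (algebraMap K₁ (AlgebraicClosure K₁) : K₁ →* AlgebraicClosure K₁) c) =
      Units.map (algebraMap K₂ (AlgebraicClosure K₂) : K₂ →* AlgebraicClosure K₂)
        (Units.map (φ₀ : K₁ →* K₂) c) := by
  apply Units.ext
  rw [Units.coe_mapEquiv, Units.coe_map, Units.coe_map, Units.coe_map]
  exact hφ c

/-! ### Absolute units: integrality transport along `φ` -/

section Integral

variable [ValuativeRel K₁] [ValuativeRel K₂] (hφ₀ : ∀ x : K₁, x ∈ 𝒪[K₁] ↔ φ₀ x ∈ 𝒪[K₂])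

include hφ hφ₀ in
/-- Integrality over `𝒪_K` transports along `φ` (over `φ₀|_{𝒪_{K₁}}`, abc-iut-L1-d4's `integerHom`).
[cite: MochizukiFrdII2008, Thm 2.4 (i) p.20] -/
theorem isIntegral_map {y : AlgebraicClosure K₁} (hy : IsIntegral 𝒪[K₁] y) :
    IsIntegral 𝒪[K₂] (φ y) := by
  refine hy.map_of_comp_eq (integerHom φ₀ hφ₀) (φ : AlgebraicClosure K₁ →+* AlgebraicClosure K₂)
    (RingHom.ext fun r => ?_)
  change algebraMap 𝒪[K₂] (AlgebraicClosure K₂) (integerHom φ₀ hφ₀ r) =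
    φ (algebraMap 𝒪[K₁] (AlgebraicClosure K₁) r)
  rw [IsScalarTower.algebraMap_apply 𝒪[K₂] K₂ (AlgebraicClosure K₂),
    IsScalarTower.algebraMap_apply 𝒪[K₁] K₁ (AlgebraicClosure K₁), hφ]
  rfl

include hφ hφ₀ in
/-- `y` is an absolute integer iff `φ y` is. [cite: MochizukiFrdII2008, Thm 2.4 (i) p.20] -/
theorem mem_absIntegers_iff (y : AlgebraicClosure K₁) :
    y ∈ absIntegers 𝒪[K₁] K₁ ↔ φ y ∈ absIntegers 𝒪[K₂] K₂ := by
  rw [absIntegers, absIntegers, mem_integralClosure_iff, mem_integralClosure_iff]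
  refine ⟨isIntegral_map φ₀ φ hφ hφ₀, fun h => ?_⟩
  have h' := isIntegral_map φ₀.symm φ.symm (symm_algebraMap φ₀ φ hφ) (hφ₀_symm φ₀ hφ₀) h
  rwa [RingEquiv.symm_apply_apply] at h'

include hφ hφ₀ in
/-- **`ψ̄ := φ|_{K̄₁ˣ}` carries absolute units onto absolute units** (`PreservesAbsUnits`).
[cite: MochizukiFrdII2008, Thm 2.4 (i) p.20] -/
theorem preservesAbsUnits_unitsMapEquiv : PreservesAbsUnits (Units.mapEquiv φ.toMulEquiv) := by
  intro x
  have h1 : ((Units.mapEquiv φ.toMulEquiv x : (AlgebraicClosure K₂)ˣ) : AlgebraicClosure K₂) =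
      φ (x : AlgebraicClosure K₁) := Units.coe_mapEquiv _ _
  have h2 : (((Units.mapEquiv φ.toMulEquiv x)⁻¹ : (AlgebraicClosure K₂)ˣ) : AlgebraicClosure K₂) =
      φ ((x⁻¹ : (AlgebraicClosure K₁)ˣ) : AlgebraicClosure K₁) := by
    rw [← map_inv]; exact Units.coe_mapEquiv _ _
  rw [h1, h2]
  exact and_congr (mem_absIntegers_iff φ₀ φ hφ hφ₀ _) (mem_absIntegers_iff φ₀ φ hφ hφ₀ _)

end Integral

/-! ### Uniformisers: a valuative `φ₀` carries uniformisers to uniformisers -/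

section Uniformizer

/-- In a non-archimedean local field a value `< 1` is `≤` the value of a uniformiser (the value group
is `unifValue ^ ℤ` with `0 < unifValue < 1`). [cite: SerreLocalFields1979, Ch. II §3] -/
theorem le_unifValue_of_lt_one (F : Type) [Field F] [ValuativeRel F] [TopologicalSpace F]
    [IsNonarchimedeanLocalField F] {y : F} (hy : valuation F y < 1) :
    valuation F y ≤ unifValue F := by
  by_cases hy0 : y = 0
  · rw [hy0, map_zero]; exact zero_le
  obtain ⟨k, hk⟩ := exists_valuation_eq_unifValue_zpow F hy0
  rw [hk] at hy ⊢
  have hk1 : 0 < k := (zpow_lt_one_iff_right_of_lt_one₀ (unifValue_pos F) (unifValue_lt_one F)).mp hy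
  calc unifValue F ^ k ≤ unifValue F ^ (1 : ℤ) :=
        zpow_le_zpow_right_of_le_one₀ (unifValue_pos F) (unifValue_lt_one F).le hk1
    _ = unifValue F := zpow_one _

variable [ValuativeRel K₁] [TopologicalSpace K₁] [IsNonarchimedeanLocalField K₁]
  [ValuativeRel K₂] [TopologicalSpace K₂] [IsNonarchimedeanLocalField K₂]
  (hφ₀ : ∀ x : K₁, x ∈ 𝒪[K₁] ↔ φ₀ x ∈ 𝒪[K₂])

include hφ₀ in
omit [TopologicalSpace K₁] [IsNonarchimedeanLocalField K₁] [TopologicalSpace K₂]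
  [IsNonarchimedeanLocalField K₂] in
/-- Along a valuative `φ₀`, an element of `K₂` of value `≥ 1` pulls back to an element of value `≥ 1`:
contrapositive form `v₁ (φ₀⁻¹ z) < 1` for `v₂ z < 1`. [cite: SerreLocalFields1979, Ch. II §3] -/
theorem valuation_symm_lt_one {z : K₂} (hz : valuation K₂ z < 1) : valuation K₁ (φ₀.symm z) < 1 := by
  by_cases hz0 : z = 0
  · rw [hz0, map_zero, map_zero]; exact zero_lt_one
  by_contra hge
  rw [not_lt] at hge
  -- then `(φ₀⁻¹ z)⁻¹ ∈ 𝒪[K₁]`, so `z⁻¹ ∈ 𝒪[K₂]`, i.e. `v₂ z ≥ 1`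
  have hx0 : φ₀.symm z ≠ 0 := fun h => hz0 (by simpa using congrArg φ₀ h)
  have hmem : (φ₀.symm z)⁻¹ ∈ 𝒪[K₁] := by
    rw [Valuation.mem_integer_iff, map_inv₀]
    exact inv_le_one_of_one_le₀ hge
  have hmem2 : z⁻¹ ∈ 𝒪[K₂] := by
    have h := (hφ₀ _).mp hmem
    rwa [map_inv₀, RingEquiv.apply_symm_apply] at h
  have h1 : valuation K₂ z⁻¹ ≤ 1 := (Valuation.mem_integer_iff _ _).mp hmem2
  rw [map_inv₀, inv_le_one₀ ((Valuation.pos_iff _).mpr hz0)] at h1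
  exact (not_lt.mpr h1) hz

include hφ₀ in
/-- **A valuative `φ₀` carries uniformisers of `K₁` to uniformisers of `K₂`.**
[cite: MochizukiFrdII2008, Thm 2.4 (ii) p.21] -/
theorem isUniformizer_map {π₁ : K₁} (hπ : (valuation K₁).IsUniformizer π₁) :
    (valuation K₂).IsUniformizer (φ₀ π₁) := by
  rw [isUniformizer_iff_valuation_eq_unifValue] at hπ ⊢
  have hπ0 : π₁ ≠ 0 := fun h => unifValue_ne_zero K₁ (by rw [← hπ, h, map_zero])
  -- (i) `v₂ (φ₀ π₁) < 1`, by the previous lemma applied to `φ₀⁻¹` … in the form: `v₁ π₁ < 1`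
  have hlt : valuation K₂ (φ₀ π₁) < 1 := by
    have h := valuation_symm_lt_one φ₀.symm (hφ₀_symm φ₀ hφ₀) (z := π₁)
      (by rw [hπ]; exact unifValue_lt_one K₁)
    simpa using h
  refine le_antisymm (le_unifValue_of_lt_one K₂ hlt) ?_
  -- (ii) `unifValue K₂ ≤ v₂ (φ₀ π₁)`: pull a uniformiser `ϖ` of `K₂` back
  obtain ⟨ϖ, hϖ⟩ := exists_isUniformizer K₂
  have hϖv : valuation K₂ (ϖ : K₂) = unifValue K₂ :=
    (isUniformizer_iff_valuation_eq_unifValue K₂ _).mp hϖ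
  have hxlt : valuation K₁ (φ₀.symm (ϖ : K₂)) < 1 :=
    valuation_symm_lt_one φ₀ hφ₀ (by rw [hϖv]; exact unifValue_lt_one K₂)
  have hxle : valuation K₁ (φ₀.symm (ϖ : K₂)) ≤ valuation K₁ π₁ := by
    rw [hπ]; exact le_unifValue_of_lt_one K₁ hxlt
  have hmem : φ₀.symm (ϖ : K₂) / π₁ ∈ 𝒪[K₁] := by
    rw [Valuation.mem_integer_iff, map_div₀]
    exact div_le_one_of_le₀ hxle zero_le
  have hmem2 : (ϖ : K₂) / φ₀ π₁ ∈ 𝒪[K₂] := by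
    have h := (hφ₀ _).mp hmem
    rwa [map_div₀, RingEquiv.apply_symm_apply] at h
  have h2 : valuation K₂ (ϖ : K₂) / valuation K₂ (φ₀ π₁) ≤ 1 := by
    rw [← map_div₀]; exact (Valuation.mem_integer_iff _ _).mp hmem2
  have hpos : 0 < valuation K₂ (φ₀ π₁) :=
    (Valuation.pos_iff _).mpr (by simpa using hπ0)
  rw [← hϖv]
  exact (div_le_one₀ hpos).mp h2

include hφ hφ₀ in
/-- **`ψ̄ := φ|_{K̄₁ˣ}` carries uniformisers of `K₁` to uniformisers of `K₂`** (`PreservesUniformizers`),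
`π₁ ↦ φ₀ π₁`. [cite: MochizukiFrdII2008, Thm 2.4 (ii) p.21] -/
theorem preservesUniformizers_unitsMapEquiv : PreservesUniformizers (Units.mapEquiv φ.toMulEquiv) :=
  fun π₁ hπ₁ => ⟨Units.map (φ₀ : K₁ →* K₂) π₁, isUniformizer_map φ₀ hφ₀ hπ₁,
    unitsMapEquiv_algebraMap φ₀ φ hφ π₁⟩

end Uniformizer

end UnitsMap

/-! ### The `μ_N`-square at `Iso.ofLocalField` -/

section MuSquare

variable {K₁ K₂ : Type} [Field K₁] [Field K₂] (φ₀ : K₁ ≃+* K₂)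
  (φ : AlgebraicClosure K₁ ≃+* AlgebraicClosure K₂)
  (hφ : ∀ x : K₁, φ (algebraMap K₁ (AlgebraicClosure K₁) x) =
    algebraMap K₂ (AlgebraicClosure K₂) (φ₀ x))
  (L₁ : IntermediateField K₁ (AlgebraicClosure K₁)) (L₂ : IntermediateField K₂ (AlgebraicClosure K₂))
  [Normal K₁ L₁] [FiniteDimensional K₁ L₁] [Normal K₂ L₂] [FiniteDimensional K₂ L₂]
  (hL : ∀ y : AlgebraicClosure K₁, y ∈ L₁ ↔ φ y ∈ L₂)
  (H₁ : Subgroup (absoluteGaloisGroup K₁)) [H₁.Normal]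
  (hH₁ : IsOpen (H₁ : Set (absoluteGaloisGroup K₁)))
  (H₂ : Subgroup (absoluteGaloisGroup K₂)) [H₂.Normal]
  (hH₂ : IsOpen (H₂ : Set (absoluteGaloisGroup K₂)))
  (hH : H₁.map (galConjₜ φ₀ φ hφ).toMulEquiv.toMonoidHom = H₂)
  (S₁ : StableSubmonoid L₁) (S₂ : StableSubmonoid L₂)
  (hS : ∀ x : L₁, x ∈ S₁.toSubmonoid ↔ fieldIsoL φ L₁ L₂ hL x ∈ S₂.toSubmonoid)
  (N : ℕ) (hS₁ : ∀ x : L₁, x ^ N = 1 → x ∈ S₁.toSubmonoid)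
  (hS₂ : ∀ x : L₂, x ^ N = 1 → x ∈ S₂.toSubmonoid) (hN : 0 < N)
  (hμ₁ : ∀ ζ : rootsOfUnity N (AlgebraicClosure K₁), ((ζ : (AlgebraicClosure K₁)ˣ) : AlgebraicClosure K₁) ∈ L₁)
  (hμ₂ : ∀ ζ : rootsOfUnity N (AlgebraicClosure K₂), ((ζ : (AlgebraicClosure K₂)ˣ) : AlgebraicClosure K₂) ∈ L₂)

/-- **The `μ_N`-square `hO` at `Iso.ofLocalField`**: the `μ_N`-isomorphism induced by
`e.isoO = φ|_{O^□_{L₁}}` IS `ψ̄ = φ|_{K̄₁ˣ}` through the models `muModelOfSubmonoid` ("`Ψ` preserves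
`O^⊳(−)`", read on `N`-th roots of unity). [cite: MochizukiFrdII2008, Thm 2.4 (i) p.20] -/
theorem muIso_ofLocalField_eq_unitsMap
    (ζ : Mu N (Def22Context.ofLocalField L₁ H₁ hH₁ S₁).O) :
    (((muModelOfSubmonoid L₂ S₂ N hS₂ hN hμ₂).toMulEquiv
        ((ofLocalField φ₀ φ hφ L₁ L₂ hL H₁ hH₁ H₂ hH₂ hH S₁ S₂ hS).muIso N ζ) :
          rootsOfUnity N (AlgebraicClosure K₂)) : (AlgebraicClosure K₂)ˣ) =
      Units.mapEquiv φ.toMulEquiv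
        (((muModelOfSubmonoid L₁ S₁ N hS₁ hN hμ₁).toMulEquiv ζ :
          rootsOfUnity N (AlgebraicClosure K₁)) : (AlgebraicClosure K₁)ˣ) := by
  apply Units.ext
  rw [Units.coe_mapEquiv]
  change GalMonoid.toClosure S₂
      (((ofLocalField φ₀ φ hφ L₁ L₂ hL H₁ hH₁ H₂ hH₂ hH S₁ S₂ hS).muIso N ζ).val :
        (Def22Context.ofLocalField L₂ H₂ hH₂ S₂).O) =
    φ (GalMonoid.toClosure S₁ (ζ.val : (Def22Context.ofLocalField L₁ H₁ hH₁ S₁).O))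
  rw [coe_val_muIso, GalMonoid.toClosure_apply, GalMonoid.toClosure_apply]
  rfl

end MuSquare

/-! ### Theorem 2.4 (ii) for the field-isomorphism `Ψ` -/

section Main

variable {K₁ K₂ : Type} [Field K₁] [ValuativeRel K₁] [TopologicalSpace K₁]
  [IsNonarchimedeanLocalField K₁] [CharZero K₁] [Field K₂] [ValuativeRel K₂] [TopologicalSpace K₂]
  [IsNonarchimedeanLocalField K₂] [CharZero K₂]
  (φ₀ : K₁ ≃+* K₂) (hφ₀ : ∀ x : K₁, x ∈ 𝒪[K₁] ↔ φ₀ x ∈ 𝒪[K₂])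
  (φ : AlgebraicClosure K₁ ≃+* AlgebraicClosure K₂)
  (hφ : ∀ x : K₁, φ (algebraMap K₁ (AlgebraicClosure K₁) x) =
    algebraMap K₂ (AlgebraicClosure K₂) (φ₀ x))
  (L₁ : IntermediateField K₁ (AlgebraicClosure K₁)) (L₂ : IntermediateField K₂ (AlgebraicClosure K₂))
  [Normal K₁ L₁] [FiniteDimensional K₁ L₁] [Normal K₂ L₂] [FiniteDimensional K₂ L₂]
  (hL : ∀ y : AlgebraicClosure K₁, y ∈ L₁ ↔ φ y ∈ L₂)
  (H₁ : Subgroup (absoluteGaloisGroup K₁)) [H₁.Normal]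
  (hH₁ : IsOpen (H₁ : Set (absoluteGaloisGroup K₁)))
  (H₂ : Subgroup (absoluteGaloisGroup K₂)) [H₂.Normal]
  (hH₂ : IsOpen (H₂ : Set (absoluteGaloisGroup K₂)))
  (hH : H₁.map (galConjₜ φ₀ φ hφ).toMulEquiv.toMonoidHom = H₂)
  (S₁ : StableSubmonoid L₁) (S₂ : StableSubmonoid L₂)
  (hS : ∀ x : L₁, x ∈ S₁.toSubmonoid ↔ fieldIsoL φ L₁ L₂ hL x ∈ S₂.toSubmonoid)
  (N : ℕ) [NeZero N] (hS₁ : ∀ x : L₁, x ^ N = 1 → x ∈ S₁.toSubmonoid)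
  (hS₂ : ∀ x : L₂, x ^ N = 1 → x ∈ S₂.toSubmonoid)
  (hμ₁ : ∀ ζ : rootsOfUnity N (AlgebraicClosure K₁), ((ζ : (AlgebraicClosure K₁)ˣ) : AlgebraicClosure K₁) ∈ L₁)
  (hμ₂ : ∀ ζ : rootsOfUnity N (AlgebraicClosure K₂), ((ζ : (AlgebraicClosure K₂)ˣ) : AlgebraicClosure K₂) ∈ L₂)
  (E₁ : Type) [Field E₁] [Algebra K₁ E₁] [FiniteDimensional K₁ E₁] [Finite (MuCarrier E₁ N)]
  (hHE₁ : H₁ = galFixing K₁ (embField K₁ E₁))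
  (E₂ : Type) [Field E₂] [Algebra K₂ E₂] [FiniteDimensional K₂ E₂] [Finite (MuCarrier E₂ N)]
  (hHE₂ : H₂ = galFixing K₂ (embField K₂ E₂))

include hφ₀ in
/-- **Theorem 2.4 (ii) for the field-isomorphism `Ψ`, NO Frobenioid-side hypothesis**: for the
context isomorphism `Iso.ofLocalField …` induced by a valuative isomorphism of the field data, layers
`Eᵢ` with `Hᵢ = Gal(K̄ᵢ/Eᵢ⁰)`, residue maps `inv_{Eᵢ}` (`IsInvariantMap`) and invariants `invᵢ` pinned to
them through the constructed `fnLayerMap`: the typed `Thm24ii` holds — `ψ̄ := φ|_{K̄₁ˣ}` is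
`e.isoG`-equivariant, preserves absolute units and uniformisers, and satisfies the `μ_N`-square by
construction. [cite: MochizukiFrdII2008, Thm 2.4 (ii) p.20] -/
theorem thm24ii_ofLocalFieldIso
    (invE₁ : galoisCohomology (mu E₁ N) 2 →+ ZMod N) (invE₂ : galoisCohomology (mu E₂ N) 2 →+ ZMod N)
    (fs₁ fs₂ : Prop) (inv₁ : FNInvariant (Def22Context.ofLocalField L₁ H₁ hH₁ S₁) N)
    (inv₂ : FNInvariant (Def22Context.ofLocalField L₂ H₂ hH₂ S₂) N)
    (hpin₁ : ∀ x, inv₁.toAddEquiv x =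
      invE₁ (fnLayerMap L₁ H₁ hH₁ (MonoidHom.id _) (fun _ _ => rfl) E₁ hHE₁
        (muModelOfSubmonoid L₁ S₁ N hS₁ (NeZero.pos N) hμ₁) x))
    (hpin₂ : ∀ x, inv₂.toAddEquiv x =
      invE₂ (fnLayerMap L₂ H₂ hH₂ (MonoidHom.id _) (fun _ _ => rfl) E₂ hHE₂
        (muModelOfSubmonoid L₂ S₂ N hS₂ (NeZero.pos N) hμ₂) x)) :
    letI := FiniteExtension.valuativeRel K₁ E₁
    letI := FiniteExtension.topologicalSpace K₁ E₁
    haveI := FiniteExtension.isNonarchimedeanLocalField K₁ E₁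
    letI := FiniteExtension.valuativeRel K₂ E₂
    letI := FiniteExtension.topologicalSpace K₂ E₂
    haveI := FiniteExtension.isNonarchimedeanLocalField K₂ E₂
    IsInvariantMap E₁ N invE₁ → IsInvariantMap E₂ N invE₂ →
      Thm24ii (Def22Context.ofLocalField L₁ H₁ hH₁ S₁) (Def22Context.ofLocalField L₂ H₂ hH₂ S₂) N fs₁ fs₂
        ((ofLocalField φ₀ φ hφ L₁ L₂ hL H₁ hH₁ H₂ hH₂ hH S₁ S₂ hS).thm24Data N) inv₁ inv₂ :=
  (ofLocalField φ₀ φ hφ L₁ L₂ hL H₁ hH₁ H₂ hH₂ hH S₁ S₂ hS).thm24ii_ofGalois_layers N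
    (muModelOfSubmonoid L₁ S₁ N hS₁ (NeZero.pos N) hμ₁) (muModelOfSubmonoid L₂ S₂ N hS₂ (NeZero.pos N) hμ₂)
    E₁ hHE₁ E₂ hHE₂ (Units.mapEquiv φ.toMulEquiv) (isAlphaEquivariant_unitsMapEquiv φ₀ φ hφ)
    (preservesAbsUnits_unitsMapEquiv φ₀ φ hφ hφ₀)
    (preservesUniformizers_unitsMapEquiv φ₀ φ hφ hφ₀)
    (muIso_ofLocalField_eq_unitsMap φ₀ φ hφ L₁ L₂ hL H₁ hH₁ H₂ hH₂ hH S₁ S₂ hS N hS₁ hS₂ (NeZero.pos N)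
      hμ₁ hμ₂)
    invE₁ invE₂ fs₁ fs₂ inv₁ inv₂ hpin₁ hpin₂

end Main

end Def22Context.Iso

end PadicKummer

end Literature.AlgebraicGeometry.Frobenioids

end
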